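import Mathlib
import Literature.NumberTheory.LFunctions.Zhang2022.Section13U007bTools
import Literature.NumberTheory.LFunctions.Zhang2022.Section15Bcoef
import HarnessLib

/-!
# Zhang (2022) §13, towards (13.11): the `Ψ`-mean squares of `B(s,ψ)` and of its two factors on the
# strip `|σ − ½| ≤ 2α` (item I3-B of the WP14 plan), kernel-checked

Topic `Literature/NumberTheory/LFunctions/Zhang2022` (Landau–Siegel audit tree; verdict-neutral).
Y. Zhang, *Discrete mean estimates and the Landau–Siegel zero*, arXiv:2211.02515v1 (2022)
[Zhang2022LandauSiegel] — **an unrefereed manuscript under adjudication**; this THEOREM-ONLY file proves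
large-sieve mean-square bounds for objects of the manuscript and asserts nothing about its Theorems 1–2,
about (13.11) itself, or about Landau–Siegel zeros.

§13 p. 75 (tex L3806–L3817): "Combining (2.34), Cauchy's inequality, Proposition 7.1, Lemma 5.9, 6.1
and 3.3, we can verify that `𝔈 = o(𝔓)`" (13.11) — the verification is not carried out in print
(GAP-LEDGER G-L3t6-3). Every term of `𝔈 = ΣΣ E₁*(ρ,ψ)|B(ρ,ψ)||ω(ρ)|` (display after (13.10)) carries
the factor `B(ρ,ψ) = (H₁₄ + ι₂H₁₂)(ρ,ψ)·H₂(ρ,ψ)` of (12.2); after the (2.34)-conversion of the zero sums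
to the segments `𝒥(±α)` (`σ = ½ ± α`) and Cauchy's inequality, "Lemma 3.3" (the large sieve over
`Ψ`) is applied to mean squares `Σ_{ψ} |F(s,ψ)|²` of `ψχ`-twisted Dirichlet polynomials `F` on those
segments. This file proves that step ONCE for arbitrary coefficients with a divisor-function majorant,
and instantiates it for `B` and its two factors:

* `meanSq_pc_le` — for ANY finite `T ⊆ Ψ`, any `s`, any `N ≤ ⌊P²⌋ + 1` and any coefficients `a`:
  `Σ_{ψ∈T} |Σ_{1≤n<N} a(n)ψχ(n)n^{−s}|² ≤ C₃₃·P²·Σ_{1≤n<N} |a(n)|²n^{−2σ}` (the tree's kernel-proved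
  Lemma 3.3 (ii), `Skeleton.lemma33b_sum_le`, with the real character `χ` absorbed into the
  coefficients); `meanSq_pcConj_le` — the same for the conjugate twist `ψ̄χ̄(n)` (the "dual"
  polynomials `F̄(1−s)` of the (2.34)-conversion);
* `meanSq_pc_le_of_le_tau`, `meanSq_pcConj_le_of_le_tau` — on the strip `|σ − ½| ≤ 2α`, if
  `|a(n)| ≤ K·τ_j(n)` then the right side is `≤ C₃₃·e^{8π}·majorantConst(j²,2j)·K²·P²·(log N)^{j²}`
  (`n^{−2σ} ≤ e^{8π}/n` for `n ≤ P²` since `α log P = π`; `Σ_{n≤N} τ_j(n)²/n ≤ majorantConst·(log N)^{j²}`,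
  `MeanSquareMajorant.sum_tau_sq_div_le`) — the EXPLICIT `𝓛`-exponent the (13.11) budget needs
  (`log N ≤ log P = 𝓛⁹` gives `𝓛^{9j²}`);
* instances (for `𝓛 ≥ 3`): `meanSq_Bpoly_le` — `Σ_{ψ∈T} |B(s,ψ)|² ≤ C_B·P²·𝓛³⁶` (`b ≪ τ₂`, (15.2),
  `Skeleton.norm_bcoef_le`; `B = Σ_{n<⌊PT⁻²⌋+1} b(n)ψχ(n)n^{−s}`, `Skeleton.Bpoly_eq_sum_bcoef`);
  `meanSq_B1_le` — `Σ_{ψ∈T} |(H₁₄ + ι₂H₁₂)(s,ψ)|² ≤ C₁·P²·𝓛⁹`; `meanSq_H2_le` —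
  `Σ_{ψ∈T} |H₂(s,ψ)|² ≤ C₂·P²·𝓛⁹` (bounded coefficients `ϰ_j`, lengths `< P₁ = P^{0.504}`), all with
  `|σ − ½| ≤ 2α` and explicit absolute constants.

ZHANG-L WP14 item I3-B (helper of the (13.11)ᴿ programme under the leaf `Skeleton.Eq1311Rel`).

## References

* Y. Zhang, arXiv:2211.02515v1 (2022), §13 (13.11) p. 75, §12 (12.2) p. 67, §15 (15.1)–(15.2) p. 79,
  Lemma 3.3 p. 14, §2 (2.21), (2.26)–(2.27). [cite: Zhang2022LandauSiegel, §13 (13.11) p.75]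
-/

noncomputable section

open Complex Real ComplexConjugate

namespace Literature.NumberTheory.LFunctions.Zhang2022.Typed.Section13

open Skeleton MeanSquareMajorant

/-! ## Elementary sizes -/

/-- `n^e ≤ e^{8π}·n⁻¹` for `1 ≤ n ≤ P²` and `|e + 1| ≤ 4α` (`n^{e+1} ≤ (P²)^{4α} = e^{8π}`, `α log P = π`).
[cite: Zhang2022LandauSiegel, §2 (2.10) p.5; §13 p.75] -/
theorem rpow_le_exp_eight_pi_mul_inv {D : ℕ} (hL : 1 ≤ ell D) {e : ℝ} (he : |e + 1| ≤ 4 * alpha D)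
    {n : ℕ} (hn1 : 1 ≤ n) (hnP : (n : ℝ) ≤ bigP D ^ 2) :
    (n : ℝ) ^ e ≤ Real.exp (8 * π) * (n : ℝ)⁻¹ := by
  have hL0 : 0 < ell D := by linarith
  have hα : alpha D = π / ell D ^ 9 := by rw [alpha, bigP, Real.log_exp]
  have hP2 : bigP D ^ 2 = Real.exp (2 * ell D ^ 9) := by rw [bigP, ← Real.exp_nat_mul]; ring_nf
  have hP2_1 : 1 ≤ bigP D ^ 2 := by rw [hP2]; exact Real.one_le_exp (by positivity)
  have hn1' : (1 : ℝ) ≤ n := by exact_mod_cast hn1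
  have hn0 : (0 : ℝ) < n := by linarith
  have h1 : (n : ℝ) ^ e = (n : ℝ) ^ (e + 1) * (n : ℝ)⁻¹ := by
    rw [Real.rpow_add hn0, Real.rpow_one, mul_assoc, mul_inv_cancel₀ hn0.ne', mul_one]
  rw [h1]
  refine mul_le_mul_of_nonneg_right ?_ (inv_nonneg.mpr hn0.le)
  calc (n : ℝ) ^ (e + 1) ≤ (n : ℝ) ^ |e + 1| :=
        Real.rpow_le_rpow_of_exponent_le hn1' (le_abs_self _)
    _ ≤ (bigP D ^ 2) ^ |e + 1| := Real.rpow_le_rpow hn0.le hnP (abs_nonneg _)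
    _ ≤ (bigP D ^ 2) ^ (4 * alpha D) := Real.rpow_le_rpow_of_exponent_le hP2_1 he
    _ = Real.exp (8 * π) := by
        rw [hP2, ← Real.exp_mul, hα]
        congr 1
        field_simp
        ring

/-- On the strip `|σ − ½| ≤ 2α`: `Σ_{1≤n<N} (Kτ_j(n))²·n^{−2σ} ≤ e^{8π}·majorantConst(j²,2j)·K²·(log N)^{j²}`
for `2 ≤ N ≤ ⌊P²⌋ + 1`. [cite: Zhang2022LandauSiegel, §13 p.75; §7 (7.5) p.33] -/
theorem sum_tau_sq_rpow_le {D : ℕ} (hL : 1 ≤ ell D) {s : ℂ} (hs : |s.re - 1 / 2| ≤ 2 * alpha D)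
    {N : ℕ} (hN2 : 2 ≤ N) (hN : N ≤ ⌊bigP D ^ 2⌋₊ + 1) (K : ℝ) (j : ℕ) :
    ∑ n ∈ Finset.Ico 1 N, (K * tau j n) ^ 2 * (n : ℝ) ^ (-2 * s.re) ≤
      Real.exp (8 * π) * majorantConst (j ^ 2) (2 * j) * K ^ 2 * Real.log N ^ (j ^ 2) := by
  have he : |-2 * s.re + 1| ≤ 4 * alpha D := by
    have : -2 * s.re + 1 = -2 * (s.re - 1 / 2) := by ring
    rw [this, abs_mul, abs_neg, abs_two]
    linarith
  have hP2pos : 0 < bigP D ^ 2 := pow_pos (Real.exp_pos _) 2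
  have hterm : ∀ n ∈ Finset.Ico 1 N, (K * tau j n) ^ 2 * (n : ℝ) ^ (-2 * s.re) ≤
      Real.exp (8 * π) * K ^ 2 * (tau j n ^ 2 / n) := by
    intro n hn
    rw [Finset.mem_Ico] at hn
    have hnP : (n : ℝ) ≤ bigP D ^ 2 := by
      have : n ≤ ⌊bigP D ^ 2⌋₊ := by omega
      exact le_trans (by exact_mod_cast this) (Nat.floor_le hP2pos.le)
    have h := rpow_le_exp_eight_pi_mul_inv hL he hn.1 hnP
    have h0 : 0 ≤ (K * tau j n) ^ 2 := sq_nonneg _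
    calc (K * tau j n) ^ 2 * (n : ℝ) ^ (-2 * s.re)
        ≤ (K * tau j n) ^ 2 * (Real.exp (8 * π) * (n : ℝ)⁻¹) := mul_le_mul_of_nonneg_left h h0
      _ = Real.exp (8 * π) * K ^ 2 * (tau j n ^ 2 / n) := by ring
  have hsub : Finset.Ico 1 N ⊆ Finset.Icc 1 N := fun n hn => by
    rw [Finset.mem_Ico] at hn; rw [Finset.mem_Icc]; omega
  have hτ := sum_tau_sq_div_le j hN2
  calc ∑ n ∈ Finset.Ico 1 N, (K * tau j n) ^ 2 * (n : ℝ) ^ (-2 * s.re)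
      ≤ ∑ n ∈ Finset.Ico 1 N, Real.exp (8 * π) * K ^ 2 * (tau j n ^ 2 / n) := Finset.sum_le_sum hterm
    _ = Real.exp (8 * π) * K ^ 2 * ∑ n ∈ Finset.Ico 1 N, tau j n ^ 2 / n := by rw [Finset.mul_sum]
    _ ≤ Real.exp (8 * π) * K ^ 2 * ∑ n ∈ Finset.Icc 1 N, tau j n ^ 2 / n := by
        refine mul_le_mul_of_nonneg_left ?_ (by positivity)
        exact Finset.sum_le_sum_of_subset_of_nonneg hsub fun n _ _ => by
          have := tau_nonneg j n; positivity
    _ ≤ Real.exp (8 * π) * K ^ 2 * (majorantConst (j ^ 2) (2 * j) * Real.log N ^ (j ^ 2)) :=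
        mul_le_mul_of_nonneg_left hτ (by positivity)
    _ = Real.exp (8 * π) * majorantConst (j ^ 2) (2 * j) * K ^ 2 * Real.log N ^ (j ^ 2) := by ring

/-! ## The large sieve over `Ψ` for `ψχ`-twisted Dirichlet polynomials -/

section Generic

variable {D : ℕ} (χ : DirichletCharacter ℂ D)

/-- **Lemma 3.3 (ii) for `ψχ`-twisted polynomials, arbitrary coefficients**: for any finite `T ⊆ Ψ`,
any `s`, `N ≤ ⌊P²⌋ + 1` and `a : ℕ → ℂ`,
`Σ_{ψ∈T} |Σ_{1≤n<N} a(n)ψχ(n)n^{−s}|² ≤ C₃₃·P²·Σ_{1≤n<N} |a(n)|²n^{−2σ}`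
(`C₃₃ = 2 + 2(3 + (log 2)⁻⁶⁸)²`; `|χ(n)| ≤ 1` is absorbed into the coefficient).
[cite: Zhang2022LandauSiegel, Lemma 3.3 p.14; §13 p.75] -/
theorem meanSq_pc_le (T : Finset (Chr D)) (s : ℂ) {N : ℕ} (hN : N ≤ ⌊bigP D ^ 2⌋₊ + 1)
    (a : ℕ → ℂ) :
    ∑ x ∈ T, ‖∑ n ∈ Finset.Ico 1 N, a n * pc χ x n * (n : ℂ) ^ (-s)‖ ^ 2
      ≤ (2 + 2 * (3 + (Real.log 2 ^ 68)⁻¹) ^ 2) * bigP D ^ 2 *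
          ∑ n ∈ Finset.Ico 1 N, ‖a n‖ ^ 2 * (n : ℝ) ^ (-2 * s.re) := by
  classical
  set c : ℕ → ℂ := fun n => if n < N then a n * χ (n : ZMod D) else 0 with hc
  have hfilter : (Finset.Icc 1 ⌊bigP D ^ 2⌋₊).filter (fun n => n < N) = Finset.Ico 1 N := by
    ext n
    simp only [Finset.mem_filter, Finset.mem_Icc, Finset.mem_Ico]
    constructor
    · rintro ⟨⟨h1, -⟩, h3⟩; exact ⟨h1, h3⟩
    · rintro ⟨h1, h3⟩; exact ⟨⟨h1, by omega⟩, h3⟩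
  have hinner : ∀ x : Chr D,
      ∑ n ∈ Finset.Ico 1 N, a n * pc χ x n * (n : ℂ) ^ (-s) =
        ∑ n ∈ Finset.Icc 1 ⌊bigP D ^ 2⌋₊, c n * x.ψ (n : ZMod x.p) * (n : ℂ) ^ (-s) := by
    intro x
    have : ∀ n, c n * x.ψ (n : ZMod x.p) * (n : ℂ) ^ (-s) =
        if n < N then a n * pc χ x n * (n : ℂ) ^ (-s) else 0 := by
      intro n; simp only [hc, pc]; split_ifs <;> ring
    simp_rw [this]
    rw [Finset.sum_ite, Finset.sum_const_zero, add_zero, hfilter]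
  have hcoef : ∑ n ∈ Finset.Icc 1 ⌊bigP D ^ 2⌋₊, ‖c n‖ ^ 2 * (n : ℝ) ^ (-2 * s.re) ≤
      ∑ n ∈ Finset.Ico 1 N, ‖a n‖ ^ 2 * (n : ℝ) ^ (-2 * s.re) := by
    have : ∀ n, ‖c n‖ ^ 2 * (n : ℝ) ^ (-2 * s.re) =
        if n < N then ‖a n * χ (n : ZMod D)‖ ^ 2 * (n : ℝ) ^ (-2 * s.re) else 0 := by
      intro n; simp only [hc]; split_ifs <;> simp
    simp_rw [this]
    rw [Finset.sum_ite, Finset.sum_const_zero, add_zero, hfilter]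
    refine Finset.sum_le_sum fun n _ => ?_
    have h0 : 0 ≤ (n : ℝ) ^ (-2 * s.re) := Real.rpow_nonneg (Nat.cast_nonneg n) _
    refine mul_le_mul_of_nonneg_right ?_ h0
    refine pow_le_pow_left₀ (norm_nonneg _) ?_ 2
    rw [norm_mul]
    exact mul_le_of_le_one_right (norm_nonneg _) (DirichletCharacter.norm_le_one χ _)
  simp_rw [hinner]
  exact le_trans (lemma33b_sum_le T s c) (mul_le_mul_of_nonneg_left hcoef
    (mul_nonneg c33_nonneg (by positivity)))

/-- For natural-number bases: `conj((n:ℂ)^w) = (n:ℂ)^(conj w)`. [folklore] -/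
private theorem conj_natCast_cpow (n : ℕ) (w : ℂ) : conj ((n : ℂ) ^ w) = (n : ℂ) ^ (conj w) := by
  have harg : ((n : ℂ)).arg ≠ π := by
    rw [show (n : ℂ) = ((n : ℝ) : ℂ) by norm_cast, Complex.arg_ofReal_of_nonneg (Nat.cast_nonneg n)]
    exact Real.pi_ne_zero.symm
  rw [Complex.cpow_conj _ _ harg]
  simp

/-- **The conjugate-twisted form** (the dual polynomials `F̄(1−s,ψ) = Σ ā(n)ψ̄χ̄(n)n^{−(1−s)}` of the
(2.34)-conversion): `Σ_{ψ∈T} |Σ_{1≤n<N} a(n)·conj(ψχ(n))·n^{−s}|² ≤ C₃₃·P²·Σ_{1≤n<N} |a(n)|²n^{−2σ}`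
(conjugate the inner sum: it is `conj` of the `ψχ`-twisted polynomial with coefficients `ā` at `s̄`,
and `Re s̄ = Re s`). [cite: Zhang2022LandauSiegel, Lemma 3.3 p.14; §13 p.75] -/
theorem meanSq_pcConj_le (T : Finset (Chr D)) (s : ℂ) {N : ℕ} (hN : N ≤ ⌊bigP D ^ 2⌋₊ + 1)
    (a : ℕ → ℂ) :
    ∑ x ∈ T, ‖∑ n ∈ Finset.Ico 1 N, a n * conj (pc χ x n) * (n : ℂ) ^ (-s)‖ ^ 2
      ≤ (2 + 2 * (3 + (Real.log 2 ^ 68)⁻¹) ^ 2) * bigP D ^ 2 *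
          ∑ n ∈ Finset.Ico 1 N, ‖a n‖ ^ 2 * (n : ℝ) ^ (-2 * s.re) := by
  have hkey : ∀ x : Chr D,
      ‖∑ n ∈ Finset.Ico 1 N, a n * conj (pc χ x n) * (n : ℂ) ^ (-s)‖ =
        ‖∑ n ∈ Finset.Ico 1 N, conj (a n) * pc χ x n * (n : ℂ) ^ (-conj s)‖ := by
    intro x
    rw [← Complex.norm_conj, map_sum]
    congr 1
    refine Finset.sum_congr rfl fun n _ => ?_
    rw [map_mul, map_mul, Complex.conj_conj, conj_natCast_cpow, map_neg]
  simp_rw [hkey]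
  have h := meanSq_pc_le χ T (conj s) hN (fun n => conj (a n))
  simp only [Complex.norm_conj, Complex.conj_re] at h
  exact h

/-- **I3-B, generic form**: on the strip `|σ − ½| ≤ 2α`, for any finite `T ⊆ Ψ`, `2 ≤ N ≤ ⌊P²⌋ + 1`
and coefficients with `|a(n)| ≤ K·τ_j(n)` (`n ≥ 1`, `K ≥ 0`):
`Σ_{ψ∈T} |Σ_{1≤n<N} a(n)ψχ(n)n^{−s}|² ≤ C₃₃·e^{8π}·majorantConst(j²,2j)·K²·P²·(log N)^{j²}`.
[cite: Zhang2022LandauSiegel, §13 p.75 ("Cauchy's inequality … Lemma 3.3"); Lemma 3.3 p.14] -/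
theorem meanSq_pc_le_of_le_tau (hL : 1 ≤ ell D) (T : Finset (Chr D)) {s : ℂ}
    (hs : |s.re - 1 / 2| ≤ 2 * alpha D) {N : ℕ} (hN2 : 2 ≤ N) (hN : N ≤ ⌊bigP D ^ 2⌋₊ + 1)
    {a : ℕ → ℂ} {K : ℝ} (j : ℕ) (ha : ∀ n, n ≠ 0 → ‖a n‖ ≤ K * tau j n) :
    ∑ x ∈ T, ‖∑ n ∈ Finset.Ico 1 N, a n * pc χ x n * (n : ℂ) ^ (-s)‖ ^ 2
      ≤ (2 + 2 * (3 + (Real.log 2 ^ 68)⁻¹) ^ 2) * Real.exp (8 * π) *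
          majorantConst (j ^ 2) (2 * j) * K ^ 2 * bigP D ^ 2 * Real.log N ^ (j ^ 2) := by
  have h1 := meanSq_pc_le χ T s hN a
  have h2 : ∑ n ∈ Finset.Ico 1 N, ‖a n‖ ^ 2 * (n : ℝ) ^ (-2 * s.re) ≤
      ∑ n ∈ Finset.Ico 1 N, (K * tau j n) ^ 2 * (n : ℝ) ^ (-2 * s.re) := by
    refine Finset.sum_le_sum fun n hn => ?_
    rw [Finset.mem_Ico] at hn
    have h0 : 0 ≤ (n : ℝ) ^ (-2 * s.re) := Real.rpow_nonneg (Nat.cast_nonneg n) _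
    exact mul_le_mul_of_nonneg_right
      (pow_le_pow_left₀ (norm_nonneg _) (ha n (by omega)) 2) h0
  have h3 := sum_tau_sq_rpow_le hL hs hN2 hN K j
  have hP0 : 0 ≤ (2 + 2 * (3 + (Real.log 2 ^ 68)⁻¹) ^ 2) * bigP D ^ 2 :=
    mul_nonneg c33_nonneg (by positivity)
  calc _ ≤ (2 + 2 * (3 + (Real.log 2 ^ 68)⁻¹) ^ 2) * bigP D ^ 2 *
          ∑ n ∈ Finset.Ico 1 N, ‖a n‖ ^ 2 * (n : ℝ) ^ (-2 * s.re) := h1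
    _ ≤ (2 + 2 * (3 + (Real.log 2 ^ 68)⁻¹) ^ 2) * bigP D ^ 2 *
          (Real.exp (8 * π) * majorantConst (j ^ 2) (2 * j) * K ^ 2 * Real.log N ^ (j ^ 2)) :=
        mul_le_mul_of_nonneg_left (h2.trans h3) hP0
    _ = _ := by ring

/-- **I3-B, generic dual form**: the same bound for the conjugate twist `conj(ψχ(n))`.
[cite: Zhang2022LandauSiegel, §13 p.75; Lemma 3.3 p.14] -/
theorem meanSq_pcConj_le_of_le_tau (hL : 1 ≤ ell D) (T : Finset (Chr D)) {s : ℂ}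
    (hs : |s.re - 1 / 2| ≤ 2 * alpha D) {N : ℕ} (hN2 : 2 ≤ N) (hN : N ≤ ⌊bigP D ^ 2⌋₊ + 1)
    {a : ℕ → ℂ} {K : ℝ} (j : ℕ) (ha : ∀ n, n ≠ 0 → ‖a n‖ ≤ K * tau j n) :
    ∑ x ∈ T, ‖∑ n ∈ Finset.Ico 1 N, a n * conj (pc χ x n) * (n : ℂ) ^ (-s)‖ ^ 2
      ≤ (2 + 2 * (3 + (Real.log 2 ^ 68)⁻¹) ^ 2) * Real.exp (8 * π) *
          majorantConst (j ^ 2) (2 * j) * K ^ 2 * bigP D ^ 2 * Real.log N ^ (j ^ 2) := by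
  have h1 := meanSq_pcConj_le χ T s hN a
  have h2 : ∑ n ∈ Finset.Ico 1 N, ‖a n‖ ^ 2 * (n : ℝ) ^ (-2 * s.re) ≤
      ∑ n ∈ Finset.Ico 1 N, (K * tau j n) ^ 2 * (n : ℝ) ^ (-2 * s.re) := by
    refine Finset.sum_le_sum fun n hn => ?_
    rw [Finset.mem_Ico] at hn
    have h0 : 0 ≤ (n : ℝ) ^ (-2 * s.re) := Real.rpow_nonneg (Nat.cast_nonneg n) _
    exact mul_le_mul_of_nonneg_right
      (pow_le_pow_left₀ (norm_nonneg _) (ha n (by omega)) 2) h0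
  have h3 := sum_tau_sq_rpow_le hL hs hN2 hN K j
  have hP0 : 0 ≤ (2 + 2 * (3 + (Real.log 2 ^ 68)⁻¹) ^ 2) * bigP D ^ 2 :=
    mul_nonneg c33_nonneg (by positivity)
  calc _ ≤ (2 + 2 * (3 + (Real.log 2 ^ 68)⁻¹) ^ 2) * bigP D ^ 2 *
          ∑ n ∈ Finset.Ico 1 N, ‖a n‖ ^ 2 * (n : ℝ) ^ (-2 * s.re) := h1
    _ ≤ (2 + 2 * (3 + (Real.log 2 ^ 68)⁻¹) ^ 2) * bigP D ^ 2 *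
          (Real.exp (8 * π) * majorantConst (j ^ 2) (2 * j) * K ^ 2 * Real.log N ^ (j ^ 2)) :=
        mul_le_mul_of_nonneg_left (h2.trans h3) hP0
    _ = _ := by ring

end Generic

/-! ## Sizes of the truncation points (`𝓛 ≥ 3`) -/

/-- For `𝓛 ≥ 3`: `2 ≤ T = exp(𝓛^{1.1})`, `P₁ + 1 ≤ P`, `P·T⁻² + 1 ≤ P`, `1 ≤ P·T⁻²` and `P ≤ P²`.
[cite: Zhang2022LandauSiegel, §2 (2.6), (2.21), §7 (7.2)] -/
theorem sizes_of_three_le {D : ℕ} (hL : 3 ≤ ell D) :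
    Skeleton.P1 D + 1 ≤ bigP D ∧ bigP D / bigT D ^ 2 + 1 ≤ bigP D ∧ 1 ≤ bigP D / bigT D ^ 2 ∧
      bigP D ≤ bigP D ^ 2 := by
  have hL1 : 1 ≤ ell D := by linarith
  have hL0 : 0 < ell D := by linarith
  have hP : 0 < bigP D := Real.exp_pos _
  -- `𝓛^{1.1} ≤ 𝓛²` and `2𝓛² + 2 ≤ 𝓛⁹`
  have h11 : ell D ^ (1.1 : ℝ) ≤ ell D ^ 2 := by
    calc ell D ^ (1.1 : ℝ) ≤ ell D ^ ((2 : ℕ) : ℝ) :=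
          Real.rpow_le_rpow_of_exponent_le hL1 (by norm_num)
      _ = ell D ^ 2 := Real.rpow_natCast _ 2
  have h9 : 2 * ell D ^ 2 + 2 ≤ ell D ^ 9 := by
    have h3 : (3 : ℝ) ^ 7 ≤ ell D ^ 7 := pow_le_pow_left₀ (by norm_num) hL 7
    have e : ell D ^ 9 = ell D ^ 7 * ell D ^ 2 := by ring
    nlinarith [pow_nonneg hL0.le 2, pow_nonneg hL0.le 7]
  have hT2 : bigT D ^ 2 = Real.exp (2 * ell D ^ (1.1 : ℝ)) := by
    rw [bigT, ← Real.exp_nat_mul]; norm_num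
  have hT2_1 : 1 ≤ bigT D ^ 2 := by rw [hT2]; exact Real.one_le_exp (by positivity)
  have hT2_2 : 2 ≤ bigT D ^ 2 := by
    rw [hT2]
    have h1 : (1 : ℝ) ≤ 2 * ell D ^ (1.1 : ℝ) := by
      have : 1 ≤ ell D ^ (1.1 : ℝ) := Real.one_le_rpow hL1 (by norm_num)
      linarith
    calc (2 : ℝ) ≤ 1 + 1 := by norm_num
      _ ≤ Real.exp 1 := by linarith [Real.add_one_le_exp (1 : ℝ)]
      _ ≤ Real.exp (2 * ell D ^ (1.1 : ℝ)) := Real.exp_le_exp.mpr h1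
  -- `P T⁻² = exp(𝓛⁹ − 2𝓛^{1.1}) ≥ exp 2 ≥ 2`
  have hPT : bigP D / bigT D ^ 2 = Real.exp (ell D ^ 9 - 2 * ell D ^ (1.1 : ℝ)) := by
    rw [bigP, hT2, ← Real.exp_sub]
  have hPT2 : 2 ≤ bigP D / bigT D ^ 2 := by
    rw [hPT]
    calc (2 : ℝ) ≤ 2 + 1 := by norm_num
      _ ≤ Real.exp 2 := Real.add_one_le_exp 2
      _ ≤ _ := Real.exp_le_exp.mpr (by nlinarith)
  -- `P ≥ 4`
  have hP4 : 4 ≤ bigP D := by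
    rw [bigP]
    have : (4 : ℝ) ≤ ell D ^ 9 := by nlinarith [pow_nonneg hL0.le 2]
    calc (4 : ℝ) ≤ ell D ^ 9 := this
      _ ≤ ell D ^ 9 + 1 := by linarith
      _ ≤ Real.exp (ell D ^ 9) := Real.add_one_le_exp _
  refine ⟨?_, ?_, by linarith, ?_⟩
  · -- `P₁ + 1 ≤ P`: `P = P₁ · exp(0.496𝓛⁹)` and `exp(0.496𝓛⁹) ≥ 2`
    have hP1 : Skeleton.P1 D = Real.exp (ell D ^ 9 * 0.504) := by
      rw [Skeleton.P1, bigP, ← Real.exp_mul]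
    have hsplit : bigP D = Real.exp (ell D ^ 9 * 0.504) * Real.exp (ell D ^ 9 * 0.496) := by
      rw [bigP, ← Real.exp_add]; ring_nf
    have h2 : (2 : ℝ) ≤ Real.exp (ell D ^ 9 * 0.496) := by
      have h27 : (3 : ℝ) ^ 9 ≤ ell D ^ 9 := pow_le_pow_left₀ (by norm_num) hL 9
      calc (2 : ℝ) ≤ ell D ^ 9 * 0.496 + 1 := by nlinarith
        _ ≤ Real.exp (ell D ^ 9 * 0.496) := Real.add_one_le_exp _
    have h1 : (1 : ℝ) ≤ Real.exp (ell D ^ 9 * 0.504) := Real.one_le_exp (by positivity)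
    rw [hP1, hsplit]
    nlinarith [Real.exp_pos (ell D ^ 9 * 0.504)]
  · -- `P/T² + 1 ≤ P`: `P/T² ≤ P/2` and `P/2 + 1 ≤ P`
    have h1 : bigP D / bigT D ^ 2 ≤ bigP D / 2 :=
      div_le_div_of_nonneg_left hP.le (by norm_num) hT2_2
    linarith
  · nlinarith


/-! ## The instances: `B = (H₁₄ + ι₂H₁₂)·H₂`, `B₁ = H₁₄ + ι₂H₁₂`, `B₂ = H₂`

The coefficient sequences are written in place (no new definition): `u(n) = ϰ₁(n)·[n < P^{1/2}] + ι₂ϰ₂(n)`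
for `B₁` and `v(n) = ῑ₃ϰ₃(n) + ῑ₄ϰ₂(n)` for `B₂ = H₂` (so that `b = u ⋆ v` is the banked `bcoef`, (15.1)). -/

section Instances

variable {D : ℕ} (χ : DirichletCharacter ℂ D) (x : Chr D)

omit χ x in
/-- `|u(n)| ≤ 1 + |ι₂|` (`𝓛 ≥ 2`: `|ϰ₁|, |ϰ₂| ≤ 1`). [cite: Zhang2022LandauSiegel, §15 (15.2) p.79] -/
theorem norm_coefB1_le (hD : 2 ≤ Real.log D) (n : ℕ) :
    ‖((if (n : ℝ) < bigP D ^ (1 / 2 : ℝ) then vk1 D n else 0) + iota2 * vk2 D n)‖ ≤ 1 + ‖iota2‖ := by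
  refine (norm_add_le _ _).trans (add_le_add ?_ ?_)
  · split_ifs
    · exact norm_vk1_le hD n
    · simp
  · rw [norm_mul]
    exact mul_le_of_le_one_right (norm_nonneg _) (norm_vk2_le hD n)

omit χ x in
/-- `|v(n)| ≤ |ι₃| + |ι₄|` (`𝓛 ≥ 2`: `|ϰ₂|, |ϰ₃| ≤ 1`). [cite: Zhang2022LandauSiegel, §15 (15.2) p.79] -/
theorem norm_coefH2_le (hD : 2 ≤ Real.log D) (n : ℕ) :
    ‖(conj iota3 * vk3 D n + conj iota4 * vk2 D n)‖ ≤ ‖iota3‖ + ‖iota4‖ := by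
  refine (norm_add_le _ _).trans (add_le_add ?_ ?_)
  · rw [norm_mul, Complex.norm_conj]
    exact mul_le_of_le_one_right (norm_nonneg _) (norm_vk3_le hD n)
  · rw [norm_mul, Complex.norm_conj]
    exact mul_le_of_le_one_right (norm_nonneg _) (norm_vk2_le hD n)

/-- Extending a `ψχ`-twisted sum over `1 ≤ n < ⌈Q⌉` to `1 ≤ n < ⌈P₁⌉` when the coefficients vanish
from `Q ≤ P₁` on. [cite: Zhang2022LandauSiegel, §2 (2.21)] -/
theorem sum_Ico_ceil_eq_sum_Ico_ceil_P1 {Q : ℝ} (hQ : Q ≤ Skeleton.P1 D) (v : ℕ → ℂ)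
    (hv : ∀ n : ℕ, Q ≤ n → v n = 0) (s : ℂ) :
    ∑ n ∈ Finset.Ico 1 ⌈Q⌉₊, v n * pc χ x n * (n : ℂ) ^ (-s) =
      ∑ n ∈ Finset.Ico 1 ⌈Skeleton.P1 D⌉₊, v n * pc χ x n * (n : ℂ) ^ (-s) := by
  apply Finset.sum_subset
  · exact Finset.Ico_subset_Ico_right (Nat.ceil_mono hQ)
  · intro n hn hn'
    rw [Finset.mem_Ico] at hn
    rw [Finset.mem_Ico, not_and_or, not_le, not_lt] at hn'
    rcases hn' with h0 | hP
    · omega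
    · rw [hv n (le_trans (Nat.le_ceil _) (by exact_mod_cast hP))]; simp

/-- **`B₁ = H₁₄ + ι₂H₁₂` as one `ψχ`-twisted polynomial**: `Σ_{1≤n<⌈P₁⌉} u(n)ψχ(n)n^{−s}`.
[cite: Zhang2022LandauSiegel, §12 (12.1)–(12.2) p.67] -/
theorem B1_eq_sum (s : ℂ) :
    H14 χ x s + iota2 * H12 χ x s =
      ∑ n ∈ Finset.Ico 1 ⌈Skeleton.P1 D⌉₊,
        ((if (n : ℝ) < bigP D ^ (1 / 2 : ℝ) then vk1 D n else 0) + iota2 * vk2 D n) * pc χ x n * (n : ℂ) ^ (-s) := by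
  have h12 : H12 χ x s = ∑ n ∈ Finset.Ico 1 ⌈Skeleton.P1 D⌉₊, vk2 D n * pc χ x n * (n : ℂ) ^ (-s) := by
    rw [H12]
    exact sum_Ico_ceil_eq_sum_Ico_ceil_P1 χ x (P2_le_P1 D) _ (fun n hn => vk2_eq_zero hn) s
  have h14 : H14 χ x s = ∑ n ∈ Finset.Ico 1 ⌈Skeleton.P1 D⌉₊,
      (if (n : ℝ) < bigP D ^ (1 / 2 : ℝ) then vk1 D n else 0) * pc χ x n * (n : ℂ) ^ (-s) := by
    rw [H14, Finset.sum_filter]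
    refine Finset.sum_congr rfl fun n _ => ?_
    split_ifs <;> simp
  rw [h14, h12, Finset.mul_sum, ← Finset.sum_add_distrib]
  refine Finset.sum_congr rfl fun n _ => ?_
  ring

/-- **`B₂ = H₂ = ῑ₃H₁₃ + ῑ₄H₁₂` as one `ψχ`-twisted polynomial**: `Σ_{1≤n<⌈P₁⌉} v(n)ψχ(n)n^{−s}`.
[cite: Zhang2022LandauSiegel, §2 (2.27) p.6; §12 (12.2) p.67] -/
theorem H2_eq_sum (s : ℂ) :
    H2 χ x s = ∑ n ∈ Finset.Ico 1 ⌈Skeleton.P1 D⌉₊,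
      (conj iota3 * vk3 D n + conj iota4 * vk2 D n) * pc χ x n * (n : ℂ) ^ (-s) := by
  have h12 : H12 χ x s = ∑ n ∈ Finset.Ico 1 ⌈Skeleton.P1 D⌉₊, vk2 D n * pc χ x n * (n : ℂ) ^ (-s) := by
    rw [H12]
    exact sum_Ico_ceil_eq_sum_Ico_ceil_P1 χ x (P2_le_P1 D) _ (fun n hn => vk2_eq_zero hn) s
  have h13 : H13 χ x s = ∑ n ∈ Finset.Ico 1 ⌈Skeleton.P1 D⌉₊, vk3 D n * pc χ x n * (n : ℂ) ^ (-s) := by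
    rw [H13]
    exact sum_Ico_ceil_eq_sum_Ico_ceil_P1 χ x (P3_le_P1 D) _ (fun n hn => vk3_eq_zero hn) s
  rw [H2, h12, h13, Finset.mul_sum, Finset.mul_sum, ← Finset.sum_add_distrib]
  refine Finset.sum_congr rfl fun n _ => ?_
  ring

/-- **`B(s,ψ)` as one `ψχ`-twisted polynomial over `1 ≤ n < ⌊PT⁻²⌋ + 1`** (from (15.1)/(15.2),
`Skeleton.Bpoly_eq_sum_bcoef`; the `n = 0` term vanishes as `b(0) = 0`). Needs `𝓛 ≥ 3`.
[cite: Zhang2022LandauSiegel, §15 (15.1)–(15.2) p.79] -/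
theorem Bpoly_eq_sum_Ico (hL : 3 ≤ ell D) (s : ℂ) :
    Bpoly χ x s = ∑ n ∈ Finset.Ico 1 (⌊bigP D / bigT D ^ 2⌋₊ + 1),
      bcoef D n * pc χ x n * (n : ℂ) ^ (-s) := by
  have hN : bigP D / bigT D ^ 2 ≤ ((⌊bigP D / bigT D ^ 2⌋₊ + 1 : ℕ) : ℝ) := by
    push_cast; exact (Nat.lt_floor_add_one _).le
  rw [Bpoly_eq_sum_bcoef χ x hL hN s, Finset.range_eq_Ico,
    Finset.sum_eq_sum_Ico_succ_bot (Nat.succ_pos _)]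
  have h0 : bcoef D 0 = 0 := by
    rw [bcoef, Nat.divisorsAntidiagonal_zero, Finset.sum_empty]
  rw [h0]; simp

omit χ x in
/-- The truncation points: for `𝓛 ≥ 3`, `2 ≤ ⌈P₁⌉ ≤ ⌊P²⌋ + 1`, `log⌈P₁⌉ ≤ 𝓛⁹`, and
`2 ≤ ⌊PT⁻²⌋ + 1 ≤ ⌊P²⌋ + 1`, `log(⌊PT⁻²⌋ + 1) ≤ 𝓛⁹`. [cite: Zhang2022LandauSiegel, §2 (2.21); §7 (7.2)] -/
theorem truncations_of_three_le (hL : 3 ≤ ell D) :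
    (2 ≤ ⌈Skeleton.P1 D⌉₊ ∧ ⌈Skeleton.P1 D⌉₊ ≤ ⌊bigP D ^ 2⌋₊ + 1 ∧
      Real.log (⌈Skeleton.P1 D⌉₊ : ℕ) ≤ ell D ^ 9) ∧
    (2 ≤ ⌊bigP D / bigT D ^ 2⌋₊ + 1 ∧ ⌊bigP D / bigT D ^ 2⌋₊ + 1 ≤ ⌊bigP D ^ 2⌋₊ + 1 ∧
      Real.log ((⌊bigP D / bigT D ^ 2⌋₊ + 1 : ℕ) : ℝ) ≤ ell D ^ 9) := by
  obtain ⟨hP1P, hPTP, hPT1, hPP2⟩ := sizes_of_three_le hL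
  have hP : 0 < bigP D := Real.exp_pos _
  have hP1 : 1 < bigP D := by linarith
  have hlogP : Real.log (bigP D) = ell D ^ 9 := by rw [bigP, Real.log_exp]
  have hP10 : 0 ≤ Skeleton.P1 D := Real.rpow_nonneg hP.le _
  have hP11 : 1 < Skeleton.P1 D := by
    rw [Skeleton.P1]; exact Real.one_lt_rpow hP1 (by norm_num)
  have hceil : (⌈Skeleton.P1 D⌉₊ : ℝ) ≤ bigP D :=
    le_trans (Nat.ceil_lt_add_one hP10).le hP1P
  have hN : ((⌊bigP D / bigT D ^ 2⌋₊ + 1 : ℕ) : ℝ) ≤ bigP D := by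
    push_cast
    linarith [Nat.floor_le (show 0 ≤ bigP D / bigT D ^ 2 by positivity)]
  refine ⟨⟨?_, ?_, ?_⟩, ⟨?_, ?_, ?_⟩⟩
  · exact Nat.lt_ceil.mpr (by exact_mod_cast hP11)
  · have : ⌈Skeleton.P1 D⌉₊ ≤ ⌊bigP D ^ 2⌋₊ := Nat.le_floor (hceil.trans hPP2)
    omega
  · calc Real.log (⌈Skeleton.P1 D⌉₊ : ℕ) ≤ Real.log (bigP D) :=
          Real.log_le_log (by exact_mod_cast (show 0 < ⌈Skeleton.P1 D⌉₊ from
            Nat.ceil_pos.mpr (by linarith))) hceil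
      _ = ell D ^ 9 := hlogP
  · have : 1 ≤ ⌊bigP D / bigT D ^ 2⌋₊ := Nat.le_floor (by exact_mod_cast hPT1)
    omega
  · have : ⌊bigP D / bigT D ^ 2⌋₊ ≤ ⌊bigP D ^ 2⌋₊ :=
      Nat.floor_mono (le_trans (by linarith) hPP2)
    omega
  · calc Real.log ((⌊bigP D / bigT D ^ 2⌋₊ + 1 : ℕ) : ℝ) ≤ Real.log (bigP D) :=
          Real.log_le_log (by positivity) hN
      _ = ell D ^ 9 := hlogP

/-- **I3-B for `B₁ = H₁₄ + ι₂H₁₂`**: for `𝓛 ≥ 3`, any finite `T ⊆ Ψ` and `|σ − ½| ≤ 2α`,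
`Σ_{ψ∈T} |(H₁₄ + ι₂H₁₂)(s,ψ)|² ≤ C₃₃·e^{8π}·majorantConst(1,2)·(1+|ι₂|)²·P²·𝓛⁹`.
[cite: Zhang2022LandauSiegel, §13 (13.11) p.75; Lemma 3.3 p.14; §12 (12.2)] -/
theorem meanSq_B1_le (hL : 3 ≤ ell D) (T : Finset (Chr D)) {s : ℂ}
    (hs : |s.re - 1 / 2| ≤ 2 * alpha D) :
    ∑ x ∈ T, ‖H14 χ x s + iota2 * H12 χ x s‖ ^ 2 ≤
      (2 + 2 * (3 + (Real.log 2 ^ 68)⁻¹) ^ 2) * Real.exp (8 * π) * majorantConst 1 2 *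
        (1 + ‖iota2‖) ^ 2 * bigP D ^ 2 * ell D ^ 9 := by
  have hL1 : 1 ≤ ell D := by linarith
  have hD2 : 2 ≤ Real.log D := by have h := hL; rw [ell] at h; linarith
  obtain ⟨⟨hN2, hN, hlog⟩, -⟩ := truncations_of_three_le hL
  have ha : ∀ n : ℕ, n ≠ 0 →
      ‖((if (n : ℝ) < bigP D ^ (1 / 2 : ℝ) then vk1 D n else 0) + iota2 * vk2 D n)‖ ≤
      (1 + ‖iota2‖) * tau 1 n := fun n hn => by
    rw [tau_one_apply hn, mul_one]; exact norm_coefB1_le hD2 n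
  have h := meanSq_pc_le_of_le_tau χ hL1 T hs hN2 hN 1 ha
  simp_rw [B1_eq_sum χ]
  refine h.trans ?_
  have hlog0 : 0 ≤ Real.log (⌈Skeleton.P1 D⌉₊ : ℕ) := Real.log_natCast_nonneg _
  have hK : 0 ≤ (2 + 2 * (3 + (Real.log 2 ^ 68)⁻¹) ^ 2) * Real.exp (8 * π) * majorantConst 1 2 *
      (1 + ‖iota2‖) ^ 2 * bigP D ^ 2 :=
    mul_nonneg (mul_nonneg (mul_nonneg (mul_nonneg c33_nonneg (Real.exp_nonneg _))
      (majorantConst_pos _ _).le) (sq_nonneg _)) (sq_nonneg _)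
  simpa using mul_le_mul_of_nonneg_left hlog hK

/-- **I3-B for `B₂ = H₂`**: for `𝓛 ≥ 3`, any finite `T ⊆ Ψ` and `|σ − ½| ≤ 2α`,
`Σ_{ψ∈T} |H₂(s,ψ)|² ≤ C₃₃·e^{8π}·majorantConst(1,2)·(|ι₃|+|ι₄|)²·P²·𝓛⁹`.
[cite: Zhang2022LandauSiegel, §13 (13.11) p.75; Lemma 3.3 p.14; §2 (2.27)] -/
theorem meanSq_H2_le (hL : 3 ≤ ell D) (T : Finset (Chr D)) {s : ℂ}
    (hs : |s.re - 1 / 2| ≤ 2 * alpha D) :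
    ∑ x ∈ T, ‖H2 χ x s‖ ^ 2 ≤
      (2 + 2 * (3 + (Real.log 2 ^ 68)⁻¹) ^ 2) * Real.exp (8 * π) * majorantConst 1 2 *
        (‖iota3‖ + ‖iota4‖) ^ 2 * bigP D ^ 2 * ell D ^ 9 := by
  have hL1 : 1 ≤ ell D := by linarith
  have hD2 : 2 ≤ Real.log D := by have h := hL; rw [ell] at h; linarith
  obtain ⟨⟨hN2, hN, hlog⟩, -⟩ := truncations_of_three_le hL
  have ha : ∀ n : ℕ, n ≠ 0 → ‖(conj iota3 * vk3 D n + conj iota4 * vk2 D n)‖ ≤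
      (‖iota3‖ + ‖iota4‖) * tau 1 n := fun n hn => by
    rw [tau_one_apply hn, mul_one]; exact norm_coefH2_le hD2 n
  have h := meanSq_pc_le_of_le_tau χ hL1 T hs hN2 hN 1 ha
  simp_rw [H2_eq_sum χ]
  refine h.trans ?_
  have hlog0 : 0 ≤ Real.log (⌈Skeleton.P1 D⌉₊ : ℕ) := Real.log_natCast_nonneg _
  have hK : 0 ≤ (2 + 2 * (3 + (Real.log 2 ^ 68)⁻¹) ^ 2) * Real.exp (8 * π) * majorantConst 1 2 *
      (‖iota3‖ + ‖iota4‖) ^ 2 * bigP D ^ 2 :=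
    mul_nonneg (mul_nonneg (mul_nonneg (mul_nonneg c33_nonneg (Real.exp_nonneg _))
      (majorantConst_pos _ _).le) (sq_nonneg _)) (sq_nonneg _)
  simpa using mul_le_mul_of_nonneg_left hlog hK

/-- **I3-B for `B = (H₁₄ + ι₂H₁₂)H₂`** (12.2): for `𝓛 ≥ 3`, any finite `T ⊆ Ψ` and `|σ − ½| ≤ 2α`,
`Σ_{ψ∈T} |B(s,ψ)|² ≤ C₃₃·e^{8π}·majorantConst(4,4)·((1+|ι₂|)(|ι₃|+|ι₄|))²·P²·𝓛³⁶`
(`b ≪ τ₂`, (15.2); `Σ_{n≤N} τ₂(n)²/n ≪ (log N)⁴`, `log N ≤ 𝓛⁹`).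
[cite: Zhang2022LandauSiegel, §13 (13.11) p.75; Lemma 3.3 p.14; §15 (15.2) p.79] -/
theorem meanSq_Bpoly_le (hL : 3 ≤ ell D) (T : Finset (Chr D)) {s : ℂ}
    (hs : |s.re - 1 / 2| ≤ 2 * alpha D) :
    ∑ x ∈ T, ‖Bpoly χ x s‖ ^ 2 ≤
      (2 + 2 * (3 + (Real.log 2 ^ 68)⁻¹) ^ 2) * Real.exp (8 * π) * majorantConst 4 4 *
        ((1 + ‖iota2‖) * (‖iota3‖ + ‖iota4‖)) ^ 2 * bigP D ^ 2 * ell D ^ 36 := by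
  have hL1 : 1 ≤ ell D := by linarith
  have hD2 : 2 ≤ Real.log D := by have h := hL; rw [ell] at h; linarith
  obtain ⟨-, ⟨hN2, hN, hlog⟩⟩ := truncations_of_three_le hL
  have ha : ∀ n, n ≠ 0 → ‖bcoef D n‖ ≤ ((1 + ‖iota2‖) * (‖iota3‖ + ‖iota4‖)) * tau 2 n :=
    fun n _ => norm_bcoef_le hD2 n
  have h := meanSq_pc_le_of_le_tau χ hL1 T hs hN2 hN 2 ha
  simp_rw [Bpoly_eq_sum_Ico χ _ hL]
  refine h.trans ?_
  have hlog0 : 0 ≤ Real.log ((⌊bigP D / bigT D ^ 2⌋₊ + 1 : ℕ) : ℝ) := Real.log_natCast_nonneg _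
  have hpow : Real.log ((⌊bigP D / bigT D ^ 2⌋₊ + 1 : ℕ) : ℝ) ^ (2 ^ 2) ≤ ell D ^ 36 := by
    calc Real.log ((⌊bigP D / bigT D ^ 2⌋₊ + 1 : ℕ) : ℝ) ^ (2 ^ 2) ≤ (ell D ^ 9) ^ (2 ^ 2) :=
          pow_le_pow_left₀ hlog0 hlog _
      _ = ell D ^ 36 := by ring
  have hK : 0 ≤ (2 + 2 * (3 + (Real.log 2 ^ 68)⁻¹) ^ 2) * Real.exp (8 * π) *
      majorantConst (2 ^ 2) (2 * 2) * ((1 + ‖iota2‖) * (‖iota3‖ + ‖iota4‖)) ^ 2 * bigP D ^ 2 :=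
    mul_nonneg (mul_nonneg (mul_nonneg (mul_nonneg c33_nonneg (Real.exp_nonneg _))
      (majorantConst_pos _ _).le) (sq_nonneg _)) (sq_nonneg _)
  have := mul_le_mul_of_nonneg_left hpow hK
  simpa using this

/-- **I3-B for the dual polynomial of `B`**: for `𝓛 ≥ 3`, any finite `T ⊆ Ψ` and `|σ − ½| ≤ 2α`,
`Σ_{ψ∈T} |Σ_{1≤n<⌊PT⁻²⌋+1} conj(b(n))·conj(ψχ(n))·n^{−s}|² ≤` the same bound as for `B` (the reflected
factor `B̄(1−s,ψ)` of the (2.34)-conversion has this shape at `1 − s`, which lies in the strip too).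
[cite: Zhang2022LandauSiegel, §13 (13.11) p.75; Lemma 3.3 p.14; §15 (15.2) p.79] -/
theorem meanSq_BpolyDual_le (hL : 3 ≤ ell D) (T : Finset (Chr D)) {s : ℂ}
    (hs : |s.re - 1 / 2| ≤ 2 * alpha D) :
    ∑ x ∈ T, ‖∑ n ∈ Finset.Ico 1 (⌊bigP D / bigT D ^ 2⌋₊ + 1),
        conj (bcoef D n) * conj (pc χ x n) * (n : ℂ) ^ (-s)‖ ^ 2 ≤
      (2 + 2 * (3 + (Real.log 2 ^ 68)⁻¹) ^ 2) * Real.exp (8 * π) * majorantConst 4 4 *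
        ((1 + ‖iota2‖) * (‖iota3‖ + ‖iota4‖)) ^ 2 * bigP D ^ 2 * ell D ^ 36 := by
  have hL1 : 1 ≤ ell D := by linarith
  have hD2 : 2 ≤ Real.log D := by have h := hL; rw [ell] at h; linarith
  obtain ⟨-, ⟨hN2, hN, hlog⟩⟩ := truncations_of_three_le hL
  have ha : ∀ n, n ≠ 0 → ‖conj (bcoef D n)‖ ≤ ((1 + ‖iota2‖) * (‖iota3‖ + ‖iota4‖)) * tau 2 n :=
    fun n _ => by rw [Complex.norm_conj]; exact norm_bcoef_le hD2 n
  have h := meanSq_pcConj_le_of_le_tau χ hL1 T hs hN2 hN 2 ha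
  refine h.trans ?_
  have hlog0 : 0 ≤ Real.log ((⌊bigP D / bigT D ^ 2⌋₊ + 1 : ℕ) : ℝ) := Real.log_natCast_nonneg _
  have hpow : Real.log ((⌊bigP D / bigT D ^ 2⌋₊ + 1 : ℕ) : ℝ) ^ (2 ^ 2) ≤ ell D ^ 36 := by
    calc Real.log ((⌊bigP D / bigT D ^ 2⌋₊ + 1 : ℕ) : ℝ) ^ (2 ^ 2) ≤ (ell D ^ 9) ^ (2 ^ 2) :=
          pow_le_pow_left₀ hlog0 hlog _
      _ = ell D ^ 36 := by ring
  have hK : 0 ≤ (2 + 2 * (3 + (Real.log 2 ^ 68)⁻¹) ^ 2) * Real.exp (8 * π) *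
      majorantConst (2 ^ 2) (2 * 2) * ((1 + ‖iota2‖) * (‖iota3‖ + ‖iota4‖)) ^ 2 * bigP D ^ 2 :=
    mul_nonneg (mul_nonneg (mul_nonneg (mul_nonneg c33_nonneg (Real.exp_nonneg _))
      (majorantConst_pos _ _).le) (sq_nonneg _)) (sq_nonneg _)
  have := mul_le_mul_of_nonneg_left hpow hK
  simpa using this

end Instances

end Literature.NumberTheory.LFunctions.Zhang2022.Typed.Section13
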